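import Summits.RiemannHypothesis.RiemannHypothesis.Theorems.Splittings.NbNaturalVisibility
import HarnessLib

/-!
# NB natural visibility — closed form of the level law in `(H, B, ρ₀, κ)` (SPLIT-nb-neg gen 7 §13 supplement; zero-def follow-up)

Cell rh-split, seat rh-split-nb-neg g7 (brief sha16 f79c5f09d8bcb036), card `run/shared/lean/pub/rh-split/cards/SPLIT-nb-neg.md` §13
SUPPLEMENT: the two declarations by which the seat's `NbNaturalVisibility.v2.lean` (sha16 f911519ba8c43567) extends the LANDED
`Theorems/Splittings/NbNaturalVisibility.lean` (p500066 = v1 1484c78da54b1e9f, decls 1–6 byte-identical), filed as their own small file by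
rh-split-typer-1 g4 (lead rh-split-lead g3 RULING #22 (viii) «≤ 70-line NbNaturalVisibilityClosed.lean»; referee rh-split-ref g3 REFEREE NOTE
(nb, neg) §13 SUPPLEMENT 05:22:53Z: farm rc 0/0/0, std on `kernel_visibility_explicit`, read-back verbatim, labels «two RH-FREE KERNEL
THEOREMS; class (nb, neg) UNCHANGED»).  Same namespace as the landed file; decl blocks verbatim.
* `prefix_sum_le` — `Σ_{N<H} log² N · I_N(0,1) ≤ H⁵ κ` (via `norm_levinsonMollifierLog_le_sq`);
* `kernel_visibility_explicit` — the tree's `kernel_visibility` ∘ `prefix_sum_le`: the visibility law in `(H, B, ρ₀, κ)` alone.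
HONEST LABEL: «SPLITTING SEARCH over kernel-typed RH-EQUIVALENCES; a splitting A ∧ B ⟹ RH is CONDITIONAL bookkeeping unless A and B are
both proved; nothing here bears on the truth of RH.»
-/

set_option linter.dupNamespace false

noncomputable section

open Complex MeasureTheory Real Set

namespace Summit.RiemannHypothesis.RiemannHypothesis.Theorems.Splittings.NbNaturalVisibility

open Literature.Barriers.RiemannHypothesis
open Literature.Barriers.RiemannHypothesis.BettinGonek2017
open Literature.NumberTheory.LFunctions (bcfDistSq bcfDistSq_nonneg)
open Summit.RiemannHypothesis.RiemannHypothesis.Theorems.Splittings.NbGrowthDetectors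
  (mollifiedSecondMoment_zero_one_le)

/-! ## Closed form in `(H, B, ρ₀, κ)`: the prefix is at most `H⁵ κ` -/

/-- **Prefix bound.** `∑_{N<H} log² N · I_N(0,1) ≤ H⁵ κ`, from `‖M_N(½+it) log N‖ ≤ N²`
(`norm_levinsonMollifierLog_le_sq`) and `log² N · I_N(0,1) = ∫_0^1 ‖M_N log N‖² |ζ|²`. Crude but
RH-free and explicit. [folklore] -/
theorem prefix_sum_le (H : ℕ) :
    ∑ N ∈ Finset.range H, Real.log N ^ 2 * mollifiedSecondMoment N 0 1 ≤
      (H : ℝ) ^ 5 * ∫ t in (0 : ℝ)..1, ‖riemannZeta (1 / 2 + t * I)‖ ^ 2 := by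
  set κ : ℝ := ∫ t in (0 : ℝ)..1, ‖riemannZeta (1 / 2 + t * I)‖ ^ 2 with hκ
  have hZc : Continuous fun t : ℝ ↦ ‖riemannZeta (1 / 2 + t * I)‖ ^ 2 :=
    (Literature.NumberTheory.LFunctions.continuous_riemannZeta_line.norm).pow 2
  have hterm : ∀ N ∈ Finset.range H,
      Real.log N ^ 2 * mollifiedSecondMoment N 0 1 ≤ (H : ℝ) ^ 4 * κ := by
    intro N hN
    have hNH : (N : ℝ) ≤ H := by exact_mod_cast (Finset.mem_range.1 hN).le
    have hLc : Continuous fun t : ℝ ↦ ‖levinsonMollifierLog (N : ℝ) (1 / 2 + t * I)‖ ^ 2 :=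
      ((continuous_levinsonMollifierLog (N : ℝ)).comp (by fun_prop)).norm.pow 2
    rw [← integral_norm_sq_levinsonMollifierLog_natCast N 0 1, hκ,
      ← intervalIntegral.integral_const_mul]
    refine intervalIntegral.integral_mono_on zero_le_one ((hLc.mul hZc).intervalIntegrable _ _)
      ((continuous_const.mul hZc).intervalIntegrable _ _) fun t _ ↦ ?_
    have h1 : ‖levinsonMollifierLog (N : ℝ) (1 / 2 + t * I)‖ ≤ (N : ℝ) ^ 2 :=
      norm_levinsonMollifierLog_le_sq (by simp) _
    have h2 : ‖levinsonMollifierLog (N : ℝ) (1 / 2 + t * I)‖ ^ 2 ≤ ((H : ℝ) ^ 2) ^ 2 :=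
      calc ‖levinsonMollifierLog (N : ℝ) (1 / 2 + t * I)‖ ^ 2 ≤ ((N : ℝ) ^ 2) ^ 2 :=
            pow_le_pow_left₀ (norm_nonneg _) h1 2
        _ ≤ ((H : ℝ) ^ 2) ^ 2 := by gcongr
    calc ‖levinsonMollifierLog (N : ℝ) (1 / 2 + t * I)‖ ^ 2 * ‖riemannZeta (1 / 2 + t * I)‖ ^ 2
        ≤ ((H : ℝ) ^ 2) ^ 2 * ‖riemannZeta (1 / 2 + t * I)‖ ^ 2 := by gcongr
      _ = (H : ℝ) ^ 4 * ‖riemannZeta (1 / 2 + t * I)‖ ^ 2 := by ring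
  calc ∑ N ∈ Finset.range H, Real.log N ^ 2 * mollifiedSecondMoment N 0 1
      ≤ ∑ N ∈ Finset.range H, (H : ℝ) ^ 4 * κ := Finset.sum_le_sum hterm
    _ = H * ((H : ℝ) ^ 4 * κ) := by rw [Finset.sum_const, Finset.card_range, nsmul_eq_mul]
    _ = (H : ℝ) ^ 5 * κ := by ring

/-- **Kernel visibility law, closed form in `(H, B, ρ₀, κ)`.** For a zero `ρ₀` of `ζ` with
`Re ρ₀ ≥ ½ + δ` (`δ > 0`), `B ≥ 0`, `x ≥ 2` and
`6250144 · (2 H⁵ κ + 32(2+5πB)/δ²) < c₁(ρ₀)² κ x^δ` (`κ = ∫_0^1 |ζ(½+it)|² dt`), some `N` with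
`H ≤ N ≤ ⌊x⌋ + 1` has `bcfDistSq N > B`: the tail conjunct `∀ N ≥ H, bcfDistSq N ≤ B` is refuted
below `(6250144 (2H⁵ + 32(2+5πB)/(δ² κ))/c₁(ρ₀)²)^{1/δ} + 1`. [cite: BettinGonek2017, §2 (engine)] -/
theorem kernel_visibility_explicit {ρ₀ : ℂ} (hζ : riemannZeta ρ₀ = 0) {δ : ℝ} (hδ : 0 < δ)
    (hβ : 1 / 2 + δ ≤ ρ₀.re) (H : ℕ) {B : ℝ} (hB0 : 0 ≤ B) {x : ℝ} (hx : 2 ≤ x)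
    (hbig : 6250144 * (2 * ((H : ℝ) ^ 5 * ∫ t in (0 : ℝ)..1, ‖riemannZeta (1 / 2 + t * I)‖ ^ 2) +
        32 * (2 + 5 * π * B) / δ ^ 2) <
      residueConst ρ₀ ^ 2 * (∫ t in (0 : ℝ)..1, ‖riemannZeta (1 / 2 + t * I)‖ ^ 2) * x ^ δ) :
    ∃ N : ℕ, H ≤ N ∧ N ≤ ⌊x⌋₊ + 1 ∧ B < bcfDistSq N :=
  kernel_visibility hζ hδ hβ hB0
    (mul_nonneg (by positivity) integral_norm_sq_riemannZeta_pos.le) (prefix_sum_le H) hx hbig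

end Summit.RiemannHypothesis.RiemannHypothesis.Theorems.Splittings.NbNaturalVisibility

end
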